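import Mathlib
import Summits.Ventures.HodgeRepro2.T5ValuedBallBasis

/-!
# T5AdicCompletionMap — the canonical continuous algebra `v.adicCompletion K → w.adicCompletion L`
for `w ∣ v`

Blind cell pub-hodge-repro2, seat p4 (Tier-5 Lean support, annex growth only).
Declaration per README §8(d): uses an L-value-free non-vanishing device: NO.

Mathlib's `Module.Finite Kv Lw` section — and every file of this seat on the concrete pair
(p395773, p395866, p395990, p396054-side uses) — ASSUMES a continuous algebra
`[Algebra Kv Lw] [ContinuousSMul Kv Lw] [IsScalarTower K Kv Lw]`. This file CONSTRUCTS it for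
`w` lying over `v` (`[w.asIdeal.LiesOver v.asIdeal]`), in the AKLB setting of Dedekind domains
`R ⊆ S` with fraction fields `K ⊆ L`:

* §1 the estimate `v x ≤ exp (-m) → w (algebraMap K L x) ≤ exp (-m)` for `x ∈ K` — write
  `x = (n / d) · π ^ m` with `π` a uniformiser of `v`, `d ∉ v` (so `d ∉ w`, `w d = 1`), `n ∈ R`;
* §2 the ring homomorphism `WithVal (v.valuation K) →+* Lw`, continuous by the estimate and the
  ball bases of both sides (p395675);
* §3 its extension `completionHom : Kv →+* Lw` through `UniformSpace.Completion.extensionHom`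
  (`Lw` complete and Hausdorff), continuous, restricting to `K → L → Lw` on `K`
  (`completionHom_coe`);
* §4 the INSTANCES `Algebra Kv Lw`, `ContinuousSMul Kv Lw`, `IsScalarTower K Kv Lw` — exactly the
  hypotheses assumed before, now theorems of the tree for every `w ∣ v`.

Nothing here is asserted about the Tier-5 datum.
-/

namespace Summit.Ventures.HodgeRepro2.T5AdicCompletionMap

open IsDedekindDomain HeightOneSpectrum WithZero Topology Filter
open scoped WithZero

variable {R : Type*} [CommRing R] [IsDedekindDomain R] {K : Type*} [Field K] [Algebra R K]
  [IsFractionRing R K]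
variable {S : Type*} [CommRing S] [IsDedekindDomain S] {L : Type*} [Field L] [Algebra S L]
  [IsFractionRing S L]
variable [Algebra R S] [Algebra K L] [Algebra R L] [IsScalarTower R K L] [IsScalarTower R S L]
variable (v : HeightOneSpectrum R) (w : HeightOneSpectrum S) [w.asIdeal.LiesOver v.asIdeal]

/-! ## §1 The estimate -/

omit [IsDedekindDomain R] [IsDedekindDomain S] in
/-- An element of `R` outside `v` is outside `w` (`w` lies over `v`). -/
theorem algebraMap_notMem_of_notMem {d : R} (hd : d ∉ v.asIdeal) : algebraMap R S d ∉ w.asIdeal := by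
  intro h
  apply hd
  rw [Ideal.LiesOver.over (P := w.asIdeal) (p := v.asIdeal)]
  exact Ideal.mem_comap.mpr h

omit [IsDedekindDomain R] [IsDedekindDomain S] in
/-- An element of `v` maps into `w`. -/
theorem algebraMap_mem_of_mem {a : R} (ha : a ∈ v.asIdeal) : algebraMap R S a ∈ w.asIdeal := by
  rw [Ideal.LiesOver.over (P := w.asIdeal) (p := v.asIdeal)] at ha
  exact Ideal.mem_comap.mp ha

omit [IsDedekindDomain R] [IsFractionRing R K] [IsDedekindDomain S] [IsFractionRing S L] in
variable (S) in
/-- The two routes `R → K → L` and `R → S → L` agree. -/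
theorem algebraMap_K_L_eq (a : R) :
    algebraMap K L (algebraMap R K a) = algebraMap S L (algebraMap R S a) := by
  rw [← IsScalarTower.algebraMap_apply R K L, IsScalarTower.algebraMap_apply R S L]

omit [IsDedekindDomain R] [IsFractionRing R K] in
/-- `w (algebraMap d) = 1` for `d ∉ v`. -/
theorem valuation_algebraMap_eq_one {d : R} (hd : d ∉ v.asIdeal) :
    w.valuation L (algebraMap K L (algebraMap R K d)) = 1 := by
  rw [algebraMap_K_L_eq S, valuation_of_algebraMap, intValuation_eq_one_iff]
  exact algebraMap_notMem_of_notMem v w hd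

omit [IsDedekindDomain R] [IsFractionRing R K] in
/-- `w (algebraMap a) ≤ 1` for `a ∈ R`. -/
theorem valuation_algebraMap_le_one (a : R) :
    w.valuation L (algebraMap K L (algebraMap R K a)) ≤ 1 := by
  rw [algebraMap_K_L_eq S, valuation_of_algebraMap]
  exact intValuation_le_one w _

omit [IsFractionRing R K] in
/-- `w (algebraMap π) ≤ exp (-1)` for a uniformiser `π` of `v`. -/
theorem valuation_algebraMap_uniformizer_le {π : R} (hπ : v.intValuation π = exp (-1)) :
    w.valuation L (algebraMap K L (algebraMap R K π)) ≤ exp (-1) := by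
  have hπv : π ∈ v.asIdeal := by
    rw [← intValuation_lt_one_iff_mem, hπ, ← exp_zero, exp_lt_exp]; norm_num
  have hw : w.intValuation (algebraMap R S π) < 1 :=
    (intValuation_lt_one_iff_mem _ _).mpr (algebraMap_mem_of_mem v w hπv)
  rw [algebraMap_K_L_eq S, valuation_of_algebraMap]
  have := (T5ValuedBallBasis.lt_exp_succ_iff_le_exp (w.intValuation (algebraMap R S π)) (-1)).mp
    (by simpa using hw)
  exact this

/-- THE ESTIMATE: `v x ≤ exp (-m) → w (algebraMap x) ≤ exp (-m)` for `x ∈ K`, `m : ℕ`. -/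
theorem valuation_algebraMap_le (x : K) (m : ℕ) (hx : v.valuation K x ≤ exp (-(m : ℤ))) :
    w.valuation L (algebraMap K L x) ≤ exp (-(m : ℤ)) := by
  obtain ⟨π, hπ⟩ := intValuation_exists_uniformizer v
  have hπK : v.valuation K (algebraMap R K π) = exp (-1) := by
    rw [valuation_of_algebraMap]; exact hπ
  have hπ0 : algebraMap R K π ≠ 0 := by
    intro h; rw [h, map_zero] at hπK; exact exp_ne_zero hπK.symm
  set y : K := x / (algebraMap R K π) ^ m with hy_def
  have hy : v.valuation K y ≤ 1 := by
    rw [hy_def, map_div₀, map_pow, hπK, ← exp_nsmul, div_le_one₀ (zero_lt_iff.mpr exp_ne_zero)]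
    simpa [smul_eq_mul] using hx
  obtain ⟨n, d, hnd⟩ := exists_primeCompl_mul_eq_of_integer v y hy
  have hd0 : algebraMap R K (d : R) ≠ 0 := by
    intro h
    have : (d : R) = 0 := (IsFractionRing.injective R K) (by rw [h, map_zero])
    exact d.2 (this ▸ v.asIdeal.zero_mem)
  have hy' : y = algebraMap R K n / algebraMap R K (d : R) := by
    rw [eq_div_iff hd0]; exact hnd
  have hx' : x = y * (algebraMap R K π) ^ m := by
    rw [hy_def, div_mul_cancel₀ _ (pow_ne_zero _ hπ0)]
  rw [hx', map_mul, map_mul, map_pow, map_pow, hy', map_div₀, map_div₀,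
    valuation_algebraMap_eq_one v w d.2, div_one]
  calc w.valuation L (algebraMap K L (algebraMap R K n)) *
        w.valuation L (algebraMap K L (algebraMap R K π)) ^ m
      ≤ 1 * exp (-1) ^ m := by
        gcongr
        · exact valuation_algebraMap_le_one w n
        · exact valuation_algebraMap_uniformizer_le v w hπ
    _ = exp (-(m : ℤ)) := by rw [one_mul, ← exp_nsmul]; simp

/-! ## §2 The homomorphism `WithVal (v.valuation K) →+* Lw` and its continuity -/

variable (K L)

/-- `K → L → Lw`, read on the type synonym `WithVal (v.valuation K)` carrying the `v`-adic
topology. -/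
noncomputable def toCompletionHom : WithVal (v.valuation K) →+* w.adicCompletion L :=
  (algebraMap L (w.adicCompletion L)).comp
    ((algebraMap K L).comp (WithVal.equiv (v.valuation K)).toRingHom)

omit [Algebra R S] [Algebra R L] [IsScalarTower R K L] [IsScalarTower R S L]
  [w.asIdeal.LiesOver v.asIdeal] in
/-- `toCompletionHom x = algebraMap L Lw (algebraMap K L x)`. -/
theorem toCompletionHom_apply (x : WithVal (v.valuation K)) :
    toCompletionHom K L v w x = algebraMap L (w.adicCompletion L) (algebraMap K L
      (WithVal.equiv (v.valuation K) x)) := rfl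

omit [IsDedekindDomain R] [IsFractionRing R K] [Algebra R S] [Algebra K L] [Algebra R L]
  [IsScalarTower R K L] [IsScalarTower R S L] [w.asIdeal.LiesOver v.asIdeal] in
/-- `algebraMap L Lw y = ↑y`. -/
theorem algebraMap_L_eq_coe (y : L) :
    algebraMap L (w.adicCompletion L) y = (y : w.adicCompletion L) := by
  rw [algebraMap_adicCompletion]; rfl

/-- The estimate transported to `toCompletionHom`. -/
theorem val_toCompletionHom_le (x : WithVal (v.valuation K)) (m : ℕ)
    (hx : Valued.v x ≤ exp (-(m : ℤ))) : Valued.v (toCompletionHom K L v w x) ≤ exp (-(m : ℤ)) := by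
  rw [toCompletionHom_apply, algebraMap_L_eq_coe, valuedAdicCompletion_eq_valuation']
  exact valuation_algebraMap_le v w _ m hx

/-- `toCompletionHom` is continuous: both sides have the balls as neighbourhood bases of `0`
(p395675) and the estimate maps the ball of radius `exp (-m)` into the ball of radius
`exp (-m)`. -/
theorem continuous_toCompletionHom : Continuous (toCompletionHom K L v w) := by
  refine continuous_of_continuousAt_zero _ ?_
  rw [ContinuousAt, map_zero]
  refine ((T5ValuedBallBasis.hasBasis_nhds_zero_ball (R := WithVal (v.valuation K))).tendsto_iff
    (T5ValuedBallBasis.hasBasis_nhds_zero_ball (R := w.adicCompletion L))).mpr ?_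
  intro k _
  refine ⟨-(((-k).toNat : ℕ) : ℤ), trivial, fun x hx => ?_⟩
  have h := val_toCompletionHom_le K L v w x (-k).toNat hx
  refine h.trans (exp_le_exp.mpr ?_)
  have := Int.self_le_toNat (-k)
  omega

/-! ## §3 The completion homomorphism `Kv →+* Lw` -/

/-- THE CANONICAL MAP `v.adicCompletion K →+* w.adicCompletion L`: the extension of
`toCompletionHom` to the completion (`Lw` is complete and Hausdorff), read through Mathlib's
`adicCompletion.equiv`. -/
noncomputable def completionHom : v.adicCompletion K →+* w.adicCompletion L :=
  (UniformSpace.Completion.extensionHom (toCompletionHom K L v w)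
    (continuous_toCompletionHom K L v w)).comp (adicCompletion.equiv K v).toRingHom

/-- `completionHom` is continuous. -/
theorem continuous_completionHom : Continuous (completionHom K L v w) :=
  UniformSpace.Completion.continuous_extension.comp (adicCompletion.continuous_toCompletion K v)

/-- `completionHom` restricts to `K → L → Lw` on `K`. -/
theorem completionHom_coe (x : K) :
    completionHom K L v w (x : v.adicCompletion K) =
      ((algebraMap K L x : L) : w.adicCompletion L) := by
  change UniformSpace.Completion.extensionHom (toCompletionHom K L v w)
    (continuous_toCompletionHom K L v w) ((x : v.adicCompletion K).toCompletion) = _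
  rw [adicCompletion.coe_toCompletion]
  exact UniformSpace.Completion.extensionHom_coe _ _ _

/-! ## §4 The instances assumed by Mathlib's `Module.Finite Kv Lw` section -/

/-- The canonical algebra structure `Kv → Lw` for `w ∣ v`. -/
noncomputable instance instAlgebra : Algebra (v.adicCompletion K) (w.adicCompletion L) :=
  (completionHom K L v w).toAlgebra

/-- `algebraMap Kv Lw = completionHom`. -/
theorem algebraMap_eq_completionHom :
    algebraMap (v.adicCompletion K) (w.adicCompletion L) = completionHom K L v w := rfl

/-- The canonical algebra is continuous. -/
instance instContinuousSMul : ContinuousSMul (v.adicCompletion K) (w.adicCompletion L) :=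
  continuousSMul_of_algebraMap _ _ (continuous_completionHom K L v w)

/-- The canonical algebra is compatible with `K → L`. -/
instance instIsScalarTower : IsScalarTower K (v.adicCompletion K) (w.adicCompletion L) :=
  IsScalarTower.of_algebraMap_eq fun x => by
    have h1 : algebraMap K (v.adicCompletion K) x = (x : v.adicCompletion K) := by
      rw [algebraMap_adicCompletion]; rfl
    have h2 : algebraMap K (w.adicCompletion L) x =
        ((algebraMap K L x : L) : w.adicCompletion L) := by
      rw [algebraMap_adicCompletion]; rfl
    rw [h2, algebraMap_eq_completionHom, h1, completionHom_coe]

end Summit.Ventures.HodgeRepro2.T5AdicCompletionMap
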